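import Literature.Topology.FourManifolds.FlowerMarkingValues
import Literature.Topology.FourManifolds.SurfaceGroupCyclicShift
import Literature.Topology.FourManifolds.DehnNielsenBaerFlowerSymmetries
import HarnessLib

/-!
# Dehn–Nielsen–Baer on the flower surface: the marking at the base point and the action of the
# rotations on it

Topic `Literature/Topology/FourManifolds`; PROOF file of the named fact
`Literature.Topology.FourManifolds.DehnNielsenBaerSurfaceSmooth` (`DehnNielsenBaerSurface.lean`), first item of the
`π₁`-bookkeeping (W2) for the residue `dehnNielsenBaerSurfaceSmooth_of_flower_generators_symm`:
there, the realised classes are automorphisms of `π₁(∂V_g, x₀)` (`∂V_g` the boundary manifold of the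
flower handlebody, `x₀ = northPole`), among them the rotations `(ρ_j)_#`; to compare them with an
ALGEBRAIC generating set of `Aut S_g` one needs a marking `ν : S_g ≃* π₁(∂V_g, x₀)` with known values
and the matrix of each realised class on it.  Here:

* `FlowerModel.boundaryHomeomorph_northPole`, `FlowerModel.mapOfEq_boundaryHomeomorph_rotBoundary` —
  under `∂V_g ≃ₜ Z_g` (`boundaryHomeomorph`, the inclusion), `(ρ_j)_#` on `π₁(∂V_g, x₀)` is `(ρ_j)_#`
  on `π₁(Z_g, 0⁺)` (`FlowerMarkingValues.rotS`);
* `FlowerModel.marking n : S_{n+2} ≃* π₁(∂V_{n+2}, x₀)` — THE marking (the melon marking with values,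
  `flowerSurface_marking_values`, read on `∂V`), with `marking_of` — its value on the generator
  `(k, c)` is the class `ι_k θ_k(0, c)` of the `k`-th slice read on `∂V`;
* `FlowerModel.fundamentalGroupCongr_rotBoundary_marking` — **on the marking, `(ρ_j)_#` is the
  cyclic shift of the handles by `-j`**:
  `(ρ_j)_# ∘ ν = ν ∘ cycShiftEquiv (n+2) ((n+2) j - j)` (`SurfaceGroupCyclicShift.lean`).

Everything is proved; one definition (`marking`); no named facts (D-0026).

## References

* B. Farb, D. Margalit, *A primer on mapping class groups* (2012), Thm. 8.1 (Dehn–Nielsen–Baer;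
  the action of mapping classes on `π₁`). [FarbMargalit2012]
* H. Zieschang, E. Vogt, H.-D. Coldewey, *Surfaces and Planar Discontinuous Groups*, LNM 835 (1980),
  §3.2, Thm. 5.6.1–5.6.2. [ZieschangVogtColdewey1980]
-/

open scoped Manifold ContDiff Topology Real unitInterval
open Set Function Filter

noncomputable section

namespace Literature.Topology.FourManifolds

/-- Local notation: `𝔼 n` is the model Euclidean space `EuclideanSpace ℝ (Fin n)`. -/
local notation "𝔼 " n:arg => EuclideanSpace ℝ (Fin n)

open PlanarThickening Literature.AlgebraicTopology.FundamentalGroup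

namespace FlowerModel

variable {g : ℕ}

/-! ### §1 The boundary manifold and the flower surface: base points and rotations -/

/-- The pole lies on the flower surface. [folklore] -/
theorem top_mem_flowerSurface (hg : 2 ≤ g) : top g ∈ flowerSurface g := thicken_top (by omega)

/-- `boundaryHomeomorph` sends the base point `x₀` to the pole `0⁺`. [folklore] -/
theorem boundaryHomeomorph_northPole (hg : 2 ≤ g) :
    boundaryHomeomorph hg (northPole hg) = ⟨top g, top_mem_flowerSurface hg⟩ :=
  Subtype.ext (boundaryIncl_northPole hg)

/-- **Under `∂V_g ≃ₜ Z_g`, the rotation `ρ_j` of `∂V_g` is the rotation `ρ_j` of `Z_g`** (on `π₁`,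
at the base points `x₀ ↦ 0⁺`). [folklore] -/
theorem mapOfEq_boundaryHomeomorph_rotBoundary (hg : 2 ≤ g) (j : ℕ)
    (γ : FundamentalGroup ((𝓡∂ 3).boundary (FlowerHandlebody hg)) (northPole hg)) :
    fundamentalGroupEquivOfHomeomorph (boundaryHomeomorph hg) (boundaryHomeomorph_northPole hg)
        (Homeomorph.fundamentalGroupCongr (rotBoundary hg j).toHomeomorph (rotBoundary_northPole hg j) γ) =
      FundamentalGroup.mapOfEq (rotS (by omega) j) (rotS_top (by omega) j (top_mem_flowerSurface hg))
        (fundamentalGroupEquivOfHomeomorph (boundaryHomeomorph hg) (boundaryHomeomorph_northPole hg) γ) := by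
  simp only [fundamentalGroupEquivOfHomeomorph_apply, Homeomorph.fundamentalGroupCongr_apply]
  refine ((mapOfEq_comp_apply _ _ (rotBoundary_northPole hg j) (boundaryHomeomorph_northPole hg)
    γ).symm.trans ?_).trans (mapOfEq_comp_apply _ _ (boundaryHomeomorph_northPole hg)
      (rotS_top (by omega) j (top_mem_flowerSurface hg)) γ)
  exact mapOfEq_congr_map (ContinuousMap.ext fun z => Subtype.ext (boundaryIncl_rotBoundary hg j z))
    _ _ _

/-! ### §2 The marking of `π₁(∂V_g, x₀)` -/

/-- **The marking `ν : S_{n+2} ≃* π₁(∂V_{n+2}, x₀)`**: the melon marking with values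
(`flowerSurface_marking_values`) transported along `boundaryHomeomorph`. [cite: FarbMargalit2012, Thm. 8.1] -/
def marking (n : ℕ) :
    SurfaceGroup (n + 1 + 1) ≃*
      FundamentalGroup ((𝓡∂ 3).boundary (FlowerHandlebody (show 2 ≤ n + 2 by omega)))
        (northPole (show 2 ≤ n + 2 by omega)) :=
  (flowerSurface_marking_values (show 2 ≤ n + 2 by omega)).choose_spec.choose_spec.choose.trans
    (fundamentalGroupEquivOfHomeomorph (boundaryHomeomorph (show 2 ≤ n + 2 by omega))
      (boundaryHomeomorph_northPole (show 2 ≤ n + 2 by omega))).symm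

/-- **The values of the marking**: read on `Z_{n+2}`, `ν(k, c)` is the class `ι_k θ_k(0, c)` of the
`k`-th slice. [folklore] -/
theorem marking_of (n : ℕ) {k : ℕ} (hk : k ≤ n + 1) (c : Bool) :
    fundamentalGroupEquivOfHomeomorph (boundaryHomeomorph (show 2 ≤ n + 2 by omega))
        (boundaryHomeomorph_northPole (show 2 ≤ n + 2 by omega))
        (marking n (PresentedGroup.of ((⟨k, Nat.lt_succ_of_le hk⟩ : Fin (n + 1 + 1)), c))) =
      VanKampen.inclHomOfSubset
        ((flowerSurface_marking_values (show 2 ≤ n + 2 by omega)).choose_spec.choose k hk) (top (n + 2))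
        (range_arcK_subset (show 2 ≤ n + 2 by omega) k ⟨0, (arcK (show 2 ≤ n + 2 by omega) k).source⟩)
        (top_mem_flowerSurface (show 2 ≤ n + 2 by omega))
        (secSGenClass (show 2 ≤ n + 2 by omega) k (0, c)) := by
  rw [marking, MulEquiv.trans_apply]
  exact (MulEquiv.apply_symm_apply _ _).trans
    ((flowerSurface_marking_values (show 2 ≤ n + 2 by omega)).choose_spec.choose_spec.choose_spec
      k hk c)

/-! ### §3 The rotations act on the marking by the cyclic shift -/

/-- **On the marking, `(ρ_j)_#` is the cyclic shift of the handles by `-j`**: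
`(ρ_j)_# (ν x) = ν (cycShift_{(n+2)j - j} x)` — the rotation by `2πj/(n+2)` carries the `k`-th slice
onto the `(k - j)`-th (`mapOfEq_rotS_secSGenClass`). [cite: FarbMargalit2012, Thm. 8.1]
[cite: ZieschangVogtColdewey1980, §3.2] -/
theorem fundamentalGroupCongr_rotBoundary_marking (n j : ℕ) (x : SurfaceGroup (n + 1 + 1)) :
    Homeomorph.fundamentalGroupCongr (rotBoundary (show 2 ≤ n + 2 by omega) j).toHomeomorph
        (rotBoundary_northPole (show 2 ≤ n + 2 by omega) j) (marking n x) =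
      marking n (SurfaceGroup.cycShiftEquiv (n + 1 + 1) ((n + 1 + 1) * j - j) x) := by
  set hg : 2 ≤ n + 2 := show 2 ≤ n + 2 by omega
  -- both sides are homomorphisms of `x`; compare on the generators
  suffices h : ((Homeomorph.fundamentalGroupCongr (rotBoundary hg j).toHomeomorph
        (rotBoundary_northPole hg j)).toMonoidHom.comp (marking n).toMonoidHom) =
      (marking n).toMonoidHom.comp (SurfaceGroup.cycShiftEquiv (n + 1 + 1) ((n + 1 + 1) * j - j)).toMonoidHom by
    exact DFunLike.congr_fun h x
  refine PresentedGroup.ext fun p => ?_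
  obtain ⟨⟨k, hk'⟩, c⟩ := p
  have hk : k ≤ n + 1 := Nat.lt_succ_iff.1 hk'
  simp only [MonoidHom.coe_comp, MulEquiv.coe_toMonoidHom, comp_apply, SurfaceGroup.cycShiftEquiv_of]
  -- read everything on `Z` through `boundaryHomeomorph`
  apply (fundamentalGroupEquivOfHomeomorph (boundaryHomeomorph hg) (boundaryHomeomorph_northPole hg)).injective
  rw [mapOfEq_boundaryHomeomorph_rotBoundary, marking_of n hk c]
  have hm : ((SurfaceGroup.shiftFin ((n + 1 + 1) * j - j) ⟨k, hk'⟩ : Fin (n + 1 + 1)) : ℕ) ≤ n + 1 :=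
    Nat.lt_succ_iff.1 (SurfaceGroup.shiftFin _ _).2
  have hval := marking_of n hm c
  simp only [Fin.eta] at hval
  rw [hval]
  refine mapOfEq_rotS_secSGenClass hg ?_ _ _ _ (0, c)
  -- `(m + j) % g = k % g` for `m = (k + (gj - j)) % g`
  rw [SurfaceGroup.val_shiftFin, Nat.mod_add_mod]
  have hj : j ≤ (n + 1 + 1) * j := Nat.le_mul_of_pos_left j (by omega)
  rw [show k + ((n + 1 + 1) * j - j) + j = k + (n + 1 + 1) * j by omega, Nat.add_mul_mod_self_left]

end FlowerModel

end Literature.Topology.FourManifolds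

end
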